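import Summits.AtomisticToContinuum.Crystallization.Theorems.HullExactificationCascadeRobustBarlowTemplateTransportSteps1
import Summits.AtomisticToContinuum.Crystallization.Theorems.HullExactificationCascadeRobustBarlowTemplateTransportSteps2
import Summits.AtomisticToContinuum.Crystallization.Theorems.HullExactificationCascadeRobustBarlowTemplateTransportSteps6
import Summits.AtomisticToContinuum.Crystallization.Theorems.HullExactificationCascadeRobustBarlowTemplateTransportLower
import Summits.AtomisticToContinuum.Crystallization.Theorems.HullExactificationCascadeRobustBarlowTemplateTransportAttach1

/-!
# Line `registered` (crux `RobustBarlowTemplate`, stmt-AtomisticToContinuum-12088): swap symmetry and the attachment of transported caps (part 2/2)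

Helper lemmas for `develop_transport` (the geometric half of the development): frames
`⟨x, t₁, t₂, U⟩` read in the scale-relative integer charts `IsZChart` of an everywhere-good
configuration, their transports and the coherence of the resulting development `frameAt`.  The
only metric inputs are the chart transfer lemma `develop_transfer` and `bond_nb_iff`; everything
else is label combinatorics in `ℤ³` (pattern facts `TransportPatterns*` of the sibling crux 9227,
imported verbatim).  All `[folklore]` (HalesDSP2012 §1.3 for the two kissing patterns).

PORT of `PalmUnimodularRigidityShellsToBarlowChartTransportAttach2.lean` of the closed sibling
crux `ShellsToBarlowChart` (stmt-9227) to the SCALE-RELATIVE shell relation `y ∈ shell S x` of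
this crux (in place of the bond window `0 < dist x y ∧ dist x y ≤ 28/25`) and to the
five-argument charts `IsZChart S x P A nbr`; the port rules (conjunct paths,
`bond a b ↦ b ∈ shell S a`, the threaded symmetry hypothesis
`hsy : ∀ x ∈ S, ∀ y ∈ shell S x, x ∈ shell S y` replacing `bond_symm`, `zchart_transfer` /
`zchart_sqNormInt_eq` replacing `sqNormInt_transfer` / `IsZChart.sqNormInt_eq`, the
`open … hiding …` line) are listed under "Port notes" in `…RobustBarlowTemplateTransportSteps1.lean`
(and its extensions in `…TransportSteps6.lean`, `…TransportAttach1.lean`).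

## Port notes (this part: `TransportAttach2`)
* none beyond those rules: the signatures of `attach_lower_I_pos`, `attach_lower_I_neg`,
  `attach_J_even`, `attach_J_odd` are parallel to the source with `hsy` inserted right after
  `hch` (their proofs call `Istep_lower`, `Istep_spec`, `transfer_nb_nb`, `attach_I_even/odd`);
  the one bond inside the proofs (`hbJ`) became `nb x t₂ ∈ shell S (nb x t₁)`; the proofs are the
  source proofs verbatim up to the rules (no metric constant occurs in this part);
* the chart-agnostic lemmas `pos_form_of_lowerParity`, `neg_form_of_lowerParity`, `isFrame_swap`,
  `frameParity_swap`, `apexOf_swap`, `Jstep_swap` (9227 `Attach1`), `lowerCap_cases`,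
  `isFrame_lowerCap` (9227 `Vinv`), `apexOf_eq_of_form` (9227 `Steps6`) are used from the 9227
  modules (imported through our `…TransportAttach1`); imports: our parts 1, 2, 6, `Lower`,
  `Attach1` (the source also imports its `Vinv`, of which only the two chart-agnostic lemmas
  above are used, so our `…TransportVinv` is not imported); the `open … hiding …` line is the
  extended one of our `…TransportAttach1` (9227 `Attach2` itself is not imported, so the four
  names of this part need no hiding);
* the anchor at the end (explicit-`∀` form, registered sub-goal) is new.
-/

noncomputable section

namespace Summit.AtomisticToContinuum.Crystallization.Theorems.HullExactificationCascadeRobustBarlowTemplate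

open Literature.Geometry.DiscreteGeometry Literature.MathematicalPhysics.StatisticalMechanics
open Summit.AtomisticToContinuum.Crystallization.Theorems.PalmUnimodularRigidityShellsToBarlowChart hiding
  IsZChart TransportSystem scales_tied sqNormInt_transfer bond_symm nb_mem zlab_spec zlab_nb bond_nb_iff
  pattern_cases transfer_nb_nb transfer_nb_centre transfer_nb_target sqNormInt_zlab_centre hcp_of_mirror_pair
  Istep_spec Jstep_spec IinvStep_spec JinvStep_spec capWithAny_of_mem_cap IinvStep_Istep Istep_IinvStep
  JinvStep_Jstep Jstep_JinvStep polar_at_apex onesided_at_apex nb_inj Istep_lower Jstep_lower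
  IinvStep_lower JinvStep_lower Vstep_spec polar_at_lower_apex onesided_at_lower_apex VinvStep_spec
  attach_I_even attach_I_odd

variable {S : Set (EuclideanSpace ℝ (Fin 3))} {Pc : (EuclideanSpace ℝ (Fin 3)) → Finset (Fin 3 → ℤ)}
  {Ac : (EuclideanSpace ℝ (Fin 3)) → ((EuclideanSpace ℝ (Fin 3)) →ₗᵢ[ℝ] (EuclideanSpace ℝ (Fin 3)))}
  {nb : (EuclideanSpace ℝ (Fin 3)) → (Fin 3 → ℤ) → (EuclideanSpace ℝ (Fin 3))}

/-- **Lower attachment across I, letter below `+1`**: the letter read below is preserved by the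
I-step, and the lower apex site of `Ix` is the neighbour of `x` labelled `d + t₁` (`d` the lower
apex of `x`): in the model, `(k−1, i+1, j)` is a lower neighbour of `(k, i, j)`. [folklore] -/
theorem attach_lower_I_pos (hch : ∀ z ∈ S, IsZChart S z (Pc z) (Ac z) (nb z))
    (hsy : ∀ x ∈ S, ∀ y ∈ shell S x, x ∈ shell S y) {x : (EuclideanSpace ℝ (Fin 3))} (hx : x ∈ S) {t₁ t₂ : Fin 3 → ℤ} {U : Finset (Fin 3 → ℤ)} (hU : IsFrame (Pc x) t₁ t₂ U) (hlp : lowerParity t₁ t₂ (lowerCap (Pc x) t₁ t₂ U) = 1) (hreg : Pc (nb x t₁) = fcc3Int ∨ Pc x = hcpInt ∨ (-zlab Pc nb (nb x t₁) x ∈ Pc (nb x t₁) ∧ -zlab Pc nb (nb x t₁) (nb x t₂) ∈ Pc (nb x t₁))) : lowerParity (Istep Pc nb ⟨x, t₁, t₂, U⟩).t₁ (Istep Pc nb ⟨x, t₁, t₂, U⟩).t₂ (lowerCap (Pc (nb x t₁)) (Istep Pc nb ⟨x, t₁, t₂, U⟩).t₁ (Istep Pc nb ⟨x, t₁, t₂,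 U⟩).t₂ (Istep Pc nb ⟨x, t₁, t₂, U⟩).U) = 1 ∧ nb (nb x t₁) (apexOf (Istep Pc nb ⟨x, t₁, t₂, U⟩).t₁ (Istep Pc nb ⟨x, t₁, t₂, U⟩).t₂ (lowerCap (Pc (nb x t₁)) (Istep Pc nb ⟨x, t₁, t₂, U⟩).t₁ (Istep Pc nb ⟨x, t₁, t₂, U⟩).t₂ (Istep Pc nb ⟨x, t₁, t₂, U⟩).U)) = nb x (apexOf t₁ t₂ (lowerCap (Pc x) t₁ t₂ U) + t₁) ∧ zlab Pc nb (nb x t₁) (nb x (apexOf t₁ t₂ (lowerCap (Pc x) t₁ t₂ U) + t₁)) = apexOf (Istep Pc nb ⟨x, t₁, t₂, U⟩).t₁ (Istep Pc nb ⟨x, t₁, t₂, U⟩).t₂ (lowerCap (Pc (nb x t₁)) (Istep Pc nb ⟨x, t₁, t₂, U⟩).t₁ (Istep Pc nb ⟨x, t₁, t₂, U⟩).t₂ (Istep Pc nb ⟨x, t₁, t₂, U⟩).U) := by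
  obtain ⟨ℓ, -, -, hfiltL, hbz, Dlw, hlamL⟩ := Istep_lower hch hsy hx hU hreg
  obtain ⟨hyS, hbxy, hwP, hwx, hvP, hvnb, -, -, -, -, -, hframe, -, -⟩ := Istep_spec hch hsy hx hU hreg
  have hPx := pattern_cases hch hx
  have hPy := pattern_cases hch hyS
  obtain ⟨h12, hhex, -, -, -⟩ := id hU
  have ht₁ : t₁ ∈ Pc x := hhex (mem_hexLabels_iff.2 (Or.inl rfl))
  have ht₂ : t₂ ∈ Pc x := hhex (mem_hexLabels_iff.2 (Or.inr (Or.inl rfl)))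
  obtain ⟨hdL, hdP, hdhex, hd1, hd2, hLeq⟩ := pos_form_of_lowerParity hPx hU hlp
  set d := apexOf t₁ t₂ (lowerCap (Pc x) t₁ t₂ U) with hd_def
  have hℓ : ℓ = d + t₁ := by
    have h1 := (filter_oddCap (Pc x) hPx t₁ ht₁ t₂ ht₂ d hdP h12 hhex hdhex hd1 hd2).1
    rw [← hLeq, hfiltL] at h1
    exact Finset.singleton_injective h1
  rw [hℓ] at hbz Dlw hlamL
  have hlam := zlab_spec hch hyS (nb_mem hch hx hd1).1 hbz
  -- `D(lam, v) = 36` by transfer (`v` = label of `nb x t₂`)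
  have hbJ : nb x t₂ ∈ shell S (nb x t₁) :=
    (bond_nb_iff hch hx ht₁ ht₂).2 h12
  have Dlv : sqNormInt (zlab Pc nb (nb x t₁) (nb x (d + t₁)) - zlab Pc nb (nb x t₁) (nb x t₂)) = 36 := by
    rw [transfer_nb_nb hch hsy hx hyS hbxy hd1 ht₂ hbz hbJ]
    exact (dist_oddCap_ca (Pc x) hPx t₁ ht₁ t₂ ht₂ d hdP h12 hhex hdhex hd1 hd2).2.1
  -- the new frame and its lower cap
  set a' := (Istep Pc nb ⟨x, t₁, t₂, U⟩).t₁ with ha'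
  set b' := (Istep Pc nb ⟨x, t₁, t₂, U⟩).t₂ with hb'
  set U' := (Istep Pc nb ⟨x, t₁, t₂, U⟩).U with hU'
  obtain ⟨h12', hhex', -, -, -⟩ := id hframe
  have ha'P : a' ∈ Pc (nb x t₁) := hhex' (mem_hexLabels_iff.2 (Or.inl rfl))
  have hb'P : b' ∈ Pc (nb x t₁) := hhex' (mem_hexLabels_iff.2 (Or.inr (Or.inl rfl)))
  have hva : zlab Pc nb (nb x t₁) (nb x t₂) = b' - a' := by
    show zlab Pc nb (nb x t₁) (nb x t₂) =
      (zlab Pc nb (nb x t₁) (nb x t₂) - zlab Pc nb (nb x t₁) x) - -zlab Pc nb (nb x t₁) x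
    abel
  have Dla : sqNormInt (zlab Pc nb (nb x t₁) (nb x (d + t₁)) + a') = 18 := by
    show sqNormInt (zlab Pc nb (nb x t₁) (nb x (d + t₁)) + -zlab Pc nb (nb x t₁) x) = 18
    rw [← sub_eq_add_neg]; exact Dlw
  rw [hva] at Dlv
  obtain ⟨d', hd'L, hd'P, hd'hex, hcase⟩ := lowerCap_cases hPy hframe
  rcases hcase with ⟨hLeq', hlp', hd1', hd2'⟩ | ⟨hLeq', hlp', hd1', hd2'⟩
  · -- letter `+1` again: `lam = d'` is the lower apex of `Ix`
    have hlam' : zlab Pc nb (nb x t₁) (nb x (d + t₁)) = d' := by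
      have h1 := (filter_oddCap (Pc (nb x t₁)) hPy a' ha'P b' hb'P d' hd'P h12' hhex' hd'hex hd1' hd2').2.2.1
      rw [← hLeq'] at h1
      have hmem : zlab Pc nb (nb x t₁) (nb x (d + t₁)) ∈
          (lowerCap (Pc (nb x t₁)) a' b' U').filter (fun e => sqNormInt (e + a') = 18) :=
        Finset.mem_filter.2 ⟨hlamL, Dla⟩
      rw [h1] at hmem
      exact Finset.mem_singleton.1 hmem
    have hapex' : apexOf a' b' (lowerCap (Pc (nb x t₁)) a' b' U') = d' :=
      apexOf_eq_of_form hPy (isFrame_lowerCap hPy hframe) hd'L (Or.inr hLeq')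
    rw [hapex']
    exact ⟨hlp', by rw [← hlam']; exact hlam.2, hlam'⟩
  · -- letter `−1` is impossible: `lam = d' − a'` would touch `v = b' − a'`
    exfalso
    have hlam' : zlab Pc nb (nb x t₁) (nb x (d + t₁)) = d' - a' := by
      have h1 := (filter_evenCap (Pc (nb x t₁)) hPy a' ha'P b' hb'P d' hd'P h12' hhex' hd'hex hd1' hd2').2.2.1
      rw [← hLeq'] at h1
      have hmem : zlab Pc nb (nb x t₁) (nb x (d + t₁)) ∈
          (lowerCap (Pc (nb x t₁)) a' b' U').filter (fun e => sqNormInt (e + a') = 18) :=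
        Finset.mem_filter.2 ⟨hlamL, Dla⟩
      rw [h1] at hmem
      exact Finset.mem_singleton.1 hmem
    rw [hlam', show d' - a' - (b' - a') = d' - b' by abel] at Dlv
    have h18 := (dist_evenCap_c (Pc (nb x t₁)) hPy a' ha'P b' hb'P d' hd'P h12' hhex' hd'hex hd1' hd2').2.1
    rw [Dlv] at h18
    norm_num at h18

/-- **Lower attachment across I, letter below `−1`**: the letter read below is preserved by the
I-step, and the lower apex site `nb x d` of `x` is the neighbour of `Ix` labelled `d₊ − t₁₊`:
in the model, `(k−1, i, j)` is the lower neighbour of `(k, i+1, j)` with offset `(1, 0)`.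
[folklore] -/
theorem attach_lower_I_neg (hch : ∀ z ∈ S, IsZChart S z (Pc z) (Ac z) (nb z))
    (hsy : ∀ x ∈ S, ∀ y ∈ shell S x, x ∈ shell S y) {x : (EuclideanSpace ℝ (Fin 3))}
    (hx : x ∈ S) {t₁ t₂ : Fin 3 → ℤ} {U : Finset (Fin 3 → ℤ)} (hU : IsFrame (Pc x) t₁ t₂ U)
    (hlp : lowerParity t₁ t₂ (lowerCap (Pc x) t₁ t₂ U) = -1)
    (hreg : Pc (nb x t₁) = fcc3Int ∨ Pc x = hcpInt ∨
      (-zlab Pc nb (nb x t₁) x ∈ Pc (nb x t₁) ∧ -zlab Pc nb (nb x t₁) (nb x t₂) ∈ Pc (nb x t₁))) :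
    lowerParity (Istep Pc nb ⟨x, t₁, t₂, U⟩).t₁ (Istep Pc nb ⟨x, t₁, t₂, U⟩).t₂
        (lowerCap (Pc (nb x t₁)) (Istep Pc nb ⟨x, t₁, t₂, U⟩).t₁ (Istep Pc nb ⟨x, t₁, t₂, U⟩).t₂
          (Istep Pc nb ⟨x, t₁, t₂, U⟩).U) = -1 ∧
    nb (nb x t₁) (apexOf (Istep Pc nb ⟨x, t₁, t₂, U⟩).t₁ (Istep Pc nb ⟨x, t₁, t₂, U⟩).t₂
        (lowerCap (Pc (nb x t₁)) (Istep Pc nb ⟨x, t₁, t₂, U⟩).t₁ (Istep Pc nb ⟨x, t₁, t₂, U⟩).t₂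
          (Istep Pc nb ⟨x, t₁, t₂, U⟩).U) - (Istep Pc nb ⟨x, t₁, t₂, U⟩).t₁) =
      nb x (apexOf t₁ t₂ (lowerCap (Pc x) t₁ t₂ U)) ∧
    zlab Pc nb (nb x t₁) (nb x (apexOf t₁ t₂ (lowerCap (Pc x) t₁ t₂ U))) =
      apexOf (Istep Pc nb ⟨x, t₁, t₂, U⟩).t₁ (Istep Pc nb ⟨x, t₁, t₂, U⟩).t₂
        (lowerCap (Pc (nb x t₁)) (Istep Pc nb ⟨x, t₁, t₂, U⟩).t₁ (Istep Pc nb ⟨x, t₁, t₂, U⟩).t₂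
          (Istep Pc nb ⟨x, t₁, t₂, U⟩).U) - (Istep Pc nb ⟨x, t₁, t₂, U⟩).t₁ := by
  obtain ⟨ℓ, -, -, hfiltL, hbz, Dlw, hlamL⟩ := Istep_lower hch hsy hx hU hreg
  obtain ⟨hyS, hbxy, hwP, hwx, hvP, hvnb, -, -, -, -, -, hframe, -, -⟩ := Istep_spec hch hsy hx hU hreg
  have hPx := pattern_cases hch hx
  have hPy := pattern_cases hch hyS
  obtain ⟨h12, hhex, -, -, -⟩ := id hU
  have ht₁ : t₁ ∈ Pc x := hhex (mem_hexLabels_iff.2 (Or.inl rfl))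
  have ht₂ : t₂ ∈ Pc x := hhex (mem_hexLabels_iff.2 (Or.inr (Or.inl rfl)))
  obtain ⟨hdL, hdP, hdhex, hd1, hd2, hLeq⟩ := neg_form_of_lowerParity hPx hU hlp
  set d := apexOf t₁ t₂ (lowerCap (Pc x) t₁ t₂ U) with hd_def
  have hℓ : ℓ = d := by
    have h1 := (filter_evenCap (Pc x) hPx t₁ ht₁ t₂ ht₂ d hdP h12 hhex hdhex hd1 hd2).1
    rw [← hLeq, hfiltL] at h1
    exact Finset.singleton_injective h1
  rw [hℓ] at hbz Dlw hlamL
  have hlam := zlab_spec hch hyS (nb_mem hch hx hdP).1 hbz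
  have hbJ : nb x t₂ ∈ shell S (nb x t₁) :=
    (bond_nb_iff hch hx ht₁ ht₂).2 h12
  have Dlv : sqNormInt (zlab Pc nb (nb x t₁) (nb x d) - zlab Pc nb (nb x t₁) (nb x t₂)) = 18 := by
    rw [transfer_nb_nb hch hsy hx hyS hbxy hdP ht₂ hbz hbJ]
    exact (dist_evenCap_c (Pc x) hPx t₁ ht₁ t₂ ht₂ d hdP h12 hhex hdhex hd1 hd2).2.1
  set a' := (Istep Pc nb ⟨x, t₁, t₂, U⟩).t₁ with ha'
  set b' := (Istep Pc nb ⟨x, t₁, t₂, U⟩).t₂ with hb'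
  set U' := (Istep Pc nb ⟨x, t₁, t₂, U⟩).U with hU'
  obtain ⟨h12', hhex', -, -, -⟩ := id hframe
  have ha'P : a' ∈ Pc (nb x t₁) := hhex' (mem_hexLabels_iff.2 (Or.inl rfl))
  have hb'P : b' ∈ Pc (nb x t₁) := hhex' (mem_hexLabels_iff.2 (Or.inr (Or.inl rfl)))
  have hva : zlab Pc nb (nb x t₁) (nb x t₂) = b' - a' := by
    show zlab Pc nb (nb x t₁) (nb x t₂) =
      (zlab Pc nb (nb x t₁) (nb x t₂) - zlab Pc nb (nb x t₁) x) - -zlab Pc nb (nb x t₁) x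
    abel
  have Dla : sqNormInt (zlab Pc nb (nb x t₁) (nb x d) + a') = 18 := by
    show sqNormInt (zlab Pc nb (nb x t₁) (nb x d) + -zlab Pc nb (nb x t₁) x) = 18
    rw [← sub_eq_add_neg]; exact Dlw
  rw [hva] at Dlv
  obtain ⟨d', hd'L, hd'P, hd'hex, hcase⟩ := lowerCap_cases hPy hframe
  rcases hcase with ⟨hLeq', hlp', hd1', hd2'⟩ | ⟨hLeq', hlp', hd1', hd2'⟩
  · -- letter `+1` is impossible: `lam = d'` is at `36` from `b' − a'`
    exfalso
    have hlam' : zlab Pc nb (nb x t₁) (nb x d) = d' := by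
      have h1 := (filter_oddCap (Pc (nb x t₁)) hPy a' ha'P b' hb'P d' hd'P h12' hhex' hd'hex hd1' hd2').2.2.1
      rw [← hLeq'] at h1
      have hmem : zlab Pc nb (nb x t₁) (nb x d) ∈
          (lowerCap (Pc (nb x t₁)) a' b' U').filter (fun e => sqNormInt (e + a') = 18) :=
        Finset.mem_filter.2 ⟨hlamL, Dla⟩
      rw [h1] at hmem
      exact Finset.mem_singleton.1 hmem
    rw [hlam'] at Dlv
    have h36 := (dist_oddCap_c (Pc (nb x t₁)) hPy a' ha'P b' hb'P d' hd'P h12' hhex' hd'hex hd1' hd2').2.2.1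
    rw [Dlv] at h36
    norm_num at h36
  · have hlam' : zlab Pc nb (nb x t₁) (nb x d) = d' - a' := by
      have h1 := (filter_evenCap (Pc (nb x t₁)) hPy a' ha'P b' hb'P d' hd'P h12' hhex' hd'hex hd1' hd2').2.2.1
      rw [← hLeq'] at h1
      have hmem : zlab Pc nb (nb x t₁) (nb x d) ∈
          (lowerCap (Pc (nb x t₁)) a' b' U').filter (fun e => sqNormInt (e + a') = 18) :=
        Finset.mem_filter.2 ⟨hlamL, Dla⟩
      rw [h1] at hmem
      exact Finset.mem_singleton.1 hmem
    have hapex' : apexOf a' b' (lowerCap (Pc (nb x t₁)) a' b' U') = d' :=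
      apexOf_eq_of_form hPy (isFrame_lowerCap hPy hframe) hd'L (Or.inl hLeq')
    rw [hapex']
    exact ⟨hlp', by rw [← hlam']; exact hlam.2, hlam'⟩

/-- **Upper attachment across J, even layer** (from the I-version by the swap symmetry).
[folklore] -/
theorem attach_J_even (hch : ∀ z ∈ S, IsZChart S z (Pc z) (Ac z) (nb z))
    (hsy : ∀ x ∈ S, ∀ y ∈ shell S x, x ∈ shell S y) {x : (EuclideanSpace ℝ (Fin 3))}
    (hx : x ∈ S) {t₁ t₂ : Fin 3 → ℤ} {U : Finset (Fin 3 → ℤ)} (hU : IsFrame (Pc x) t₁ t₂ U)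
    (hpar : frameParity t₁ t₂ U = 1)
    (hreg : Pc (nb x t₂) = fcc3Int ∨ Pc x = hcpInt ∨
      (-zlab Pc nb (nb x t₂) x ∈ Pc (nb x t₂) ∧ -zlab Pc nb (nb x t₂) (nb x t₁) ∈ Pc (nb x t₂))) :
    nb (nb x t₂) (apexOf (Jstep Pc nb ⟨x, t₁, t₂, U⟩).t₁ (Jstep Pc nb ⟨x, t₁, t₂, U⟩).t₂
        (Jstep Pc nb ⟨x, t₁, t₂, U⟩).U - (Jstep Pc nb ⟨x, t₁, t₂, U⟩).t₂) = nb x (apexOf t₁ t₂ U) ∧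
    zlab Pc nb (nb x t₂) (nb x (apexOf t₁ t₂ U)) =
      apexOf (Jstep Pc nb ⟨x, t₁, t₂, U⟩).t₁ (Jstep Pc nb ⟨x, t₁, t₂, U⟩).t₂
        (Jstep Pc nb ⟨x, t₁, t₂, U⟩).U - (Jstep Pc nb ⟨x, t₁, t₂, U⟩).t₂ := by
  have hPx := pattern_cases hch hx
  have hU' : IsFrame (Pc x) t₂ t₁ U := isFrame_swap hU
  have hpar' : frameParity t₂ t₁ U = 1 := by rw [frameParity_swap]; exact hpar
  obtain ⟨h1, h2⟩ := attach_I_even hch hsy hx hU' hpar' hreg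
  obtain ⟨-, -, -, -, -, -, -, -, -, -, -, hframe', -⟩ := Istep_spec hch hsy hx hU' hreg
  have hPy := pattern_cases hch (nb_mem hch hx (hU.2.1 (mem_hexLabels_iff.2 (Or.inr (Or.inl rfl))))).1
  have ha : apexOf (Istep Pc nb ⟨x, t₂, t₁, U⟩).t₂ (Istep Pc nb ⟨x, t₂, t₁, U⟩).t₁
      (Istep Pc nb ⟨x, t₂, t₁, U⟩).U = apexOf (Istep Pc nb ⟨x, t₂, t₁, U⟩).t₁
      (Istep Pc nb ⟨x, t₂, t₁, U⟩).t₂ (Istep Pc nb ⟨x, t₂, t₁, U⟩).U := apexOf_swap hPy hframe'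
  rw [apexOf_swap hPx hU] at h1 h2
  rw [Jstep_swap]
  exact ⟨by rw [ha]; exact h1, by rw [ha]; exact h2⟩

/-- **Upper attachment across J, odd layer** (from the I-version by the swap symmetry).
[folklore] -/
theorem attach_J_odd (hch : ∀ z ∈ S, IsZChart S z (Pc z) (Ac z) (nb z))
    (hsy : ∀ x ∈ S, ∀ y ∈ shell S x, x ∈ shell S y) {x : (EuclideanSpace ℝ (Fin 3))}
    (hx : x ∈ S) {t₁ t₂ : Fin 3 → ℤ} {U : Finset (Fin 3 → ℤ)} (hU : IsFrame (Pc x) t₁ t₂ U)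
    (hpar : frameParity t₁ t₂ U = -1)
    (hreg : Pc (nb x t₂) = fcc3Int ∨ Pc x = hcpInt ∨
      (-zlab Pc nb (nb x t₂) x ∈ Pc (nb x t₂) ∧ -zlab Pc nb (nb x t₂) (nb x t₁) ∈ Pc (nb x t₂))) :
    nb (nb x t₂) (apexOf (Jstep Pc nb ⟨x, t₁, t₂, U⟩).t₁ (Jstep Pc nb ⟨x, t₁, t₂, U⟩).t₂
        (Jstep Pc nb ⟨x, t₁, t₂, U⟩).U) = nb x (apexOf t₁ t₂ U + t₂) ∧
    zlab Pc nb (nb x t₂) (nb x (apexOf t₁ t₂ U + t₂)) =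
      apexOf (Jstep Pc nb ⟨x, t₁, t₂, U⟩).t₁ (Jstep Pc nb ⟨x, t₁, t₂, U⟩).t₂
        (Jstep Pc nb ⟨x, t₁, t₂, U⟩).U := by
  have hPx := pattern_cases hch hx
  have hU' : IsFrame (Pc x) t₂ t₁ U := isFrame_swap hU
  have hpar' : frameParity t₂ t₁ U = -1 := by rw [frameParity_swap]; exact hpar
  obtain ⟨h1, h2⟩ := attach_I_odd hch hsy hx hU' hpar' hreg
  obtain ⟨-, -, -, -, -, -, -, -, -, -, -, hframe', -⟩ := Istep_spec hch hsy hx hU' hreg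
  have hPy := pattern_cases hch (nb_mem hch hx (hU.2.1 (mem_hexLabels_iff.2 (Or.inr (Or.inl rfl))))).1
  have ha : apexOf (Istep Pc nb ⟨x, t₂, t₁, U⟩).t₂ (Istep Pc nb ⟨x, t₂, t₁, U⟩).t₁
      (Istep Pc nb ⟨x, t₂, t₁, U⟩).U = apexOf (Istep Pc nb ⟨x, t₂, t₁, U⟩).t₁
      (Istep Pc nb ⟨x, t₂, t₁, U⟩).t₂ (Istep Pc nb ⟨x, t₂, t₁, U⟩).U := apexOf_swap hPy hframe'
  rw [apexOf_swap hPx hU] at h1 h2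
  rw [Jstep_swap]
  exact ⟨by rw [ha]; exact h1, by rw [ha]; exact h2⟩

/-! ## Anchor -/

/-- Anchor (registered sub-goal of stmt-AtomisticToContinuum-12088, toward `develop_transport`):
the letter `+1` read below a valid frame is preserved by the `I`-step (explicit form of the first
conjunct of `attach_lower_I_pos`, basic regime). [folklore] -/
theorem transportAttach2_anchor : ∀ (S : Set (EuclideanSpace ℝ (Fin 3))) (Pc : EuclideanSpace ℝ (Fin 3) → Finset (Fin 3 → ℤ)) (Ac : EuclideanSpace ℝ (Fin 3) → (EuclideanSpace ℝ (Fin 3) →ₗᵢ[ℝ] EuclideanSpace ℝ (Fin 3))) (nb : EuclideanSpace ℝ (Fin 3) → (Fin 3 → ℤ) → EuclideanSpace ℝ (Fin 3)), (∀ z ∈ S, IsZChart S z (Pc z) (Ac z) (nb z)) → (∀ x ∈ S, ∀ y ∈ shell S x, x ∈ shell S y) → ∀ x ∈ S, ∀ (t₁ t₂ : Fin 3 → ℤ) (U : Finset (Fin 3 → ℤ)), IsFrame (Pc x) t₁ t₂ U → lowerParity t₁ t₂ (lowerCap (Pc x) t₁ t₂ U) = 1 → (Pc (nb x t₁) = fcc3Int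 ∨ Pc x = hcpInt) → lowerParity (Istep Pc nb ⟨x, t₁, t₂, U⟩).t₁ (Istep Pc nb ⟨x, t₁, t₂, U⟩).t₂ (lowerCap (Pc (nb x t₁)) (Istep Pc nb ⟨x, t₁, t₂, U⟩).t₁ (Istep Pc nb ⟨x, t₁, t₂, U⟩).t₂ (Istep Pc nb ⟨x, t₁, t₂, U⟩).U) = 1 := by
  intro S Pc Ac nb hch hsy x hx t₁ t₂ U hU hlp hreg
  have hreg' : Pc (nb x t₁) = fcc3Int ∨ Pc x = hcpInt ∨
      (-zlab Pc nb (nb x t₁) x ∈ Pc (nb x t₁) ∧ -zlab Pc nb (nb x t₁) (nb x t₂) ∈ Pc (nb x t₁)) := by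
    rcases hreg with h | h
    · exact Or.inl h
    · exact Or.inr (Or.inl h)
  exact (attach_lower_I_pos hch hsy hx hU hlp hreg').1

end Summit.AtomisticToContinuum.Crystallization.Theorems.HullExactificationCascadeRobustBarlowTemplate

end
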